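import Summits.QuantumFields.BalabanUV.Beta.GAN24.SubAveragingMinimiserUnitTower
import Summits.QuantumFields.BalabanUV.Beta.GAN24.DirichletExhaustion
import Literature.MathematicalPhysics.QuantumFieldTheory.Balaban1983to89.B6Hprime2101

/-!
# `BalabanUV.Beta.GAN24.SubAveragingConvC` — binder row G-an2-4 ∕ (CONV-C): THE TWO SCALAR UNIT-READ CONSTITUENTS OF THE FIBRE∕STRIP LINEAGE
# IN THE CELL'S OWN TYPED TARGET PREDICATE `GAN24.DirichletExhaustion.ConvC`, BY NAME — the soft column `G_jQ_j^*` of B4 (2.48) (gen 22's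
# `Kunit`) and the hard minimiser `H_k = 𝒢Q_k^*(Q_k𝒢Q_k^*)⁻¹` of B5 (1.103) (gen 23's `KunitH`), `Re`-read, at the SHARP rate `θ = L⁻²`

NOT IN PRINT; OUR PROOF ATTEMPT (prover part P3 of row G-an2-4, fibre∕strip («Woodbury») lineage, gen 23; CRUX TEAM (2), ruling «YM REDIRECT
TOWARDS THE SUMMIT», 2026-08-21).  HONEST DEPENDENCY (cell records, verbatim): «continuum YM on T⁴ ⇐ BetaPertH ∧ nine spine estimates (0/9
proved); BetaPertH ⇐ (D1) ∧ (D4) ∧ CAP+tail; G-an2-4 gates asym, D1 and NE2/3/4.»  HONEST FRAMING (cell contract, verbatim): «discharging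
`BetaPertH` makes Bałaban's UV stability UNCONDITIONAL — a real constructive-QFT result; it is NOT the continuum limit and NOT the Clay problem.»
ABSOLUTE RULE: nothing printed is a hypothesis.  [folklore] packaging over `SubAveragingUnitTower.unitTower_two_clauses` (p252523) and
`SubAveragingMinimiserUnitTower.unitTowerH_two_clauses` (FILE C) BY NAME; `dist ≤ supNorm` on `ℤ^{d+1}` is the tree's
`B6Hprime2101.dist_le_supNorm` (b06 lineage), imported.  0 def, 0 sorry; no new mathematics.

## What is instantiated
`GAN24.DirichletExhaustion.ConvC (C : ℕ → K D N → K D N → ℝ) C₄ δ₄ θ` (the cell's TARGET SHAPE of row G-an2-4 for ONE unit-lattice-indexed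
constituent: `|C k p q| ≤ C₄e^{−δ₄ dist}` and `|C (k+1) p q − C k p q| ≤ C₄θ^k e^{−δ₄ dist}`) with `D = d+1`, `N = 1` (no internal index) and the
TRANSLATION-INVARIANT kernels
 * `C k p q = Re (Kunit (L^k) a m2 (p.1 − q.1))` — block mean over the fine leg of `G_kQ_k^*`, B4 (2.48), every `a > 0`, `m² ≥ 0` (`convC_Kunit`);
 * `C k p q = Re (KunitH (L^k) (p.1 − q.1))` — block mean over the fine leg of the massless hard minimiser `H_k` of B5 (1.103) (`convC_KunitH`),
both with `θ = (L²)⁻¹`, for EVERY `L ≥ 1` (the rate is `< 1` for `L ≥ 2`), on the INFINITE lattice `ℤ^{d+1}`.  `Re`-read as an2's packed resolvent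
(`KInv = Re K[fibInv]`); the imaginary parts obey the same bounds (not recorded).

HONEST: same content as the two `…two_clauses` theorems, re-typed so that a census line can say «(CONV-C) AS TYPED BY THE CELL holds for the
constituents G_kQ_k^* and H_k (scalar sector, U = 1, block-mean reading)».  NOT the vector objects, NOT composites, NOT `U ≠ 1`; zero on the D1
grid.  NEVER «G-an2-4 closed»; NOT D1, NOT BetaPertH, NOT continuum, NOT Clay.  Provenance: prover-b2b-balaban-gan24-p3-g23-0 (unit
`b2b-balaban-gan24-p3`, gen 23), 2026-08-21.
-/

noncomputable section

namespace Summit.QuantumFields.BalabanUV.Beta.GAN24.SubAveragingConvC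

open Complex
open Literature.MathematicalPhysics.QuantumFieldTheory.Balaban1983to89
open Literature.MathematicalPhysics.QuantumFieldTheory.Balaban1983to89.B4ContourShift (supNorm supNorm_nonneg latticeKernel)
open Literature.MathematicalPhysics.QuantumFieldTheory.Balaban1983to89.B4Sect5Exhaustion (K)
open Literature.MathematicalPhysics.QuantumFieldTheory.Balaban1983to89.B6Hprime2101 (dist_le_supNorm)
open Summit.QuantumFields.BalabanUV.Beta.GAN24.DirichletExhaustion (ConvC)
open Summit.QuantumFields.BalabanUV.Beta.GAN24.SubAveragingUnitTower (Kunit unitTower_two_clauses)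
open Summit.QuantumFields.BalabanUV.Beta.GAN24.SubAveragingMinimiserUnitTower (KunitH unitTowerH_two_clauses)

variable {d : ℕ}

/-! ## §1 From `supNorm` decay to `dist` decay on `ℤ^{d+1}` -/

/-- [folklore] `e^{−κ·supNorm(x−y)} ≤ e^{−κ·dist x y}` for `κ ≥ 0` (`dist ≤ supNorm`: `B6Hprime2101.dist_le_supNorm`). -/
theorem exp_supNorm_le_exp_dist {κ : ℝ} (hκ : 0 ≤ κ) (x y : Fin (d + 1) → ℤ) :
    Real.exp (-(κ * supNorm (x - y))) ≤ Real.exp (-(κ * dist x y)) :=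
  Real.exp_le_exp.mpr (by nlinarith [dist_le_supNorm x y, hκ])

/-- [folklore] from a two-clause tower with `supNorm` decay for complex kernels to the cell's `ConvC` for their real parts. -/
theorem convC_of_two_clauses (F : ℕ → (Fin (d + 1) → ℤ) → ℂ) {κ C θ : ℝ} (hκ : 0 < κ)
    (h1 : ∀ (j : ℕ) (x : Fin (d + 1) → ℤ), ‖F j x‖ ≤ C * Real.exp (-(κ * supNorm x)))
    (h2 : ∀ (j : ℕ) (x : Fin (d + 1) → ℤ), ‖F (j + 1) x - F j x‖ ≤ C * θ ^ j * Real.exp (-(κ * supNorm x)))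
    (hC : 0 ≤ C) (hθ : 0 ≤ θ) :
    ConvC (fun k (p q : K (d + 1) 1) => (F k (p.1 - q.1)).re) C κ θ := by
  refine ⟨fun k p q => ?_, fun k p q => ?_⟩
  · calc |(F k (p.1 - q.1)).re| ≤ ‖F k (p.1 - q.1)‖ := abs_re_le_norm _
      _ ≤ C * Real.exp (-(κ * supNorm (p.1 - q.1))) := h1 k _
      _ ≤ C * Real.exp (-(κ * dist p.1 q.1)) := mul_le_mul_of_nonneg_left (exp_supNorm_le_exp_dist hκ.le _ _) hC
  · calc |(F (k + 1) (p.1 - q.1)).re - (F k (p.1 - q.1)).re|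
        = |(F (k + 1) (p.1 - q.1) - F k (p.1 - q.1)).re| := by rw [sub_re]
      _ ≤ ‖F (k + 1) (p.1 - q.1) - F k (p.1 - q.1)‖ := abs_re_le_norm _
      _ ≤ C * θ ^ k * Real.exp (-(κ * supNorm (p.1 - q.1))) := h2 k _
      _ ≤ C * θ ^ k * Real.exp (-(κ * dist p.1 q.1)) :=
          mul_le_mul_of_nonneg_left (exp_supNorm_le_exp_dist hκ.le _ _) (mul_nonneg hC (pow_nonneg hθ k))

/-! ## §2 The two instantiations -/

/-- [folklore] **(CONV-C) AS TYPED BY THE CELL, FOR THE SOFT COLUMN `G_kQ_k^*` OF B4 (2.48)** (block mean over the fine leg, `Re`-read; gen 22's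
`unitTower_two_clauses` BY NAME): for every `a > 0`, `m² ≥ 0`, `L ≥ 1` there are `C₄ ≥ 0`, `δ₄ > 0` with
`ConvC (k p q ↦ Re (Kunit (L^k) a m2 (p.1 − q.1))) C₄ δ₄ (L²)⁻¹`. -/
theorem convC_Kunit (d : ℕ) (a m2 : ℝ) (ha : 0 < a) (hm : 0 ≤ m2) (L : ℕ) [NeZero L] :
    ∃ C₄ δ₄ : ℝ, 0 ≤ C₄ ∧ 0 < δ₄ ∧
      ConvC (fun k (p q : K (d + 1) 1) => (@Kunit d (L ^ k) ⟨pow_ne_zero k (NeZero.ne L)⟩ a m2 (p.1 - q.1)).re)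
        C₄ δ₄ (((L : ℝ) ^ 2)⁻¹) := by
  obtain ⟨κ, C, hκ, hC, h1, h2⟩ := unitTower_two_clauses d a m2 ha hm L
  exact ⟨C, κ, hC, hκ, convC_of_two_clauses
    (fun j x => @Kunit d (L ^ j) ⟨pow_ne_zero j (NeZero.ne L)⟩ a m2 x) hκ h1 h2 hC (by positivity)⟩

/-- [folklore] **(CONV-C) AS TYPED BY THE CELL, FOR THE MASSLESS HARD MINIMISER `H_k = 𝒢Q_k^*(Q_k𝒢Q_k^*)⁻¹` OF B5 (1.103)** (scalar sector, block
mean over the fine leg, `Re`-read; FILE C's `unitTowerH_two_clauses` BY NAME): for every `L ≥ 1` there are `C₄ ≥ 0`, `δ₄ > 0` with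
`ConvC (k p q ↦ Re (KunitH (L^k) (p.1 − q.1))) C₄ δ₄ (L²)⁻¹`. -/
theorem convC_KunitH (d : ℕ) (L : ℕ) [NeZero L] :
    ∃ C₄ δ₄ : ℝ, 0 ≤ C₄ ∧ 0 < δ₄ ∧
      ConvC (fun k (p q : K (d + 1) 1) => (@KunitH d (L ^ k) ⟨pow_ne_zero k (NeZero.ne L)⟩ (p.1 - q.1)).re)
        C₄ δ₄ (((L : ℝ) ^ 2)⁻¹) := by
  obtain ⟨κ, C, hκ, hC, h1, h2⟩ := unitTowerH_two_clauses d L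
  exact ⟨C, κ, hC, hκ, convC_of_two_clauses
    (fun j x => @KunitH d (L ^ j) ⟨pow_ne_zero j (NeZero.ne L)⟩ x) hκ h1 h2 hC (by positivity)⟩

end Summit.QuantumFields.BalabanUV.Beta.GAN24.SubAveragingConvC
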